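import Mathlib
import Summits.NavierStokesRegularity.NavierStokesRegularity.Theorems.FilamentSkeletonRssSkeletonEquilibriumInnerCertificateA1
import Summits.NavierStokesRegularity.NavierStokesRegularity.Theorems.FilamentSkeletonRssSkeletonEquilibriumPersistence

/-!
# Crux `SkeletonEquilibrium` (stmt-NavierStokesRegularity-15400) · birth skeleton `1408794bc945c1e9` — REGISTRY CREDIT FOR TWO STUBS ALREADY IN THE TREE

Hand `leafhand-ns-filamentskeletonrs-1` (gen 1), `--supports stmt-NavierStokesRegularity-15400`.  MODEL rung, NEGATIVE side of the ladder; bookkeeping only: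
the registered stubs `stub_innerCertificateA1` and `stub_persistence` of the birth skeleton are, VERBATIM, the theorems
`…SkeletonEquilibrium.Sketch.stub_innerCertificateA1` (`…SkeletonEquilibriumInnerCertificateA1`, p134392) and `…SkeletonEquilibrium.Sketch.stub_persistence`
(`…SkeletonEquilibriumPersistence`, p129612), landed before the stub registry tracked them.  This file re-exports them under the registered names so the
registry records the two stubs as landed; no new mathematics, the XL core stubs (`stub_lengthRegular`, `stub_kelvinSonicVerticality`,
`stub_nearVerticalSubcritical`, `stub_equilibriumFamilyA1`) and the crux stay OPEN; nothing here bears on Navier–Stokes regularity. [folklore]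
-/

set_option linter.dupNamespace false -- `NavierStokesRegularity.NavierStokesRegularity` path/namespace repetition is the tree convention

noncomputable section

namespace Summit.NavierStokesRegularity.NavierStokesRegularity.Theorems.SkeletonEquilibrium

open Filter MeasureTheory

/-- Registered stub `stub_innerCertificateA1` of crux `SkeletonEquilibrium` (birth skeleton): the inner certificate of the re-keyed C₄ datum's rational slip —
by the landed `Sketch.stub_innerCertificateA1`. [folklore] -/
theorem stub_innerCertificateA1 :
    ∀ (W Wd : ℝ → ℝ), (∀ t, W t = t / 2 - 11 / 5 + 2400 / (272 * t ^ 2 - 320 * t + 425) + 2400 / (144 * t ^ 2 + 625) +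
        2400 / (272 * t ^ 2 + 320 * t + 425)) →
      (∀ t, Wd t = 1 / 2 - 2400 * (544 * t - 320) / (272 * t ^ 2 - 320 * t + 425) ^ 2 - 2400 * (288 * t) / (144 * t ^ 2 + 625) ^ 2 -
        2400 * (544 * t + 320) / (272 * t ^ 2 + 320 * t + 425) ^ 2) →
      W (-31 / 10) ≤ -(7 / 10) ∧ 7 / 10 ≤ W (-12 / 5) ∧ (∀ t, -31 / 10 ≤ t → t ≤ -12 / 5 → 2 ≤ Wd t) ∧
        (∀ t, -10 ≤ t → t ≤ 10 → (t ≤ -31 / 10 ∨ -12 / 5 ≤ t) → 7 / 10 ≤ |W t|) :=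
  Sketch.stub_innerCertificateA1

/-- Registered stub `stub_persistence` of crux `SkeletonEquilibrium` (birth skeleton): persistence of a certified transversal zero under a `C¹`-small
perturbation — by the landed `Sketch.stub_persistence`. [folklore] -/
theorem stub_persistence :
    ∀ (f W Wd : ℝ → ℝ) (a b T m s ε : ℝ), Differentiable ℝ f → -T ≤ a → a < b → b ≤ T → 0 ≤ ε → ε < m → ε < s → W a ≤ -m → m ≤ W b →
      (∀ t, a ≤ t → t ≤ b → s ≤ Wd t) → (∀ t, -T ≤ t → t ≤ T → (t ≤ a ∨ b ≤ t) → m ≤ |W t|) →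
      (∀ t, |t| ≤ T → |f t - W t| ≤ ε ∧ |deriv f t - Wd t| ≤ ε) → (∀ t, T ≤ |t| → f t ≠ 0) →
      ∃ ts, f ts = 0 ∧ (∀ t, f t = 0 → t = ts) ∧ s - ε ≤ deriv f ts :=
  Sketch.stub_persistence

end Summit.NavierStokesRegularity.NavierStokesRegularity.Theorems.SkeletonEquilibrium

end
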